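import Mathlib
import HarnessLib
import Literature.Probability.Percolation.SharpnessDCTProofs
import Literature.Probability.Percolation.PercolationProofs
import Literature.Probability.Percolation.CriticalContinuityProofs

/-!
# STUB 2 of the crux `TruncatedSusceptibilityFiniteOfTheta` from a uniform supercritical radius tail

Crux item stmt-CriticalPhenomena-0852
(`Summit.CriticalPhenomena.PercolationContinuityZ3.Theses.PercNecklaceBackbone.TruncatedSusceptibilityFiniteOfTheta`),
line `Cruxes/TruncatedSusceptibilityFiniteOfTheta/Lines/birth.lean`, open stub `stub_criticalRadiusMoment`
(at a percolating `p_c`, `Σ_n (n+1)² · P_{p_c}(0 ↔ ∂B(n), |C(0)| < ∞) < ∞`).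

This file makes reformulation (R2) of the lead's STUB-2 analysis a kernel-checked REDUCTION. The
finite-cluster one-arm event is `E_n = siteToBoundary d n \ percolatesAt 0`, and since
`{|C(0)| = ∞} ⊆ {0 ↔ ∂B(n)}` for lattice configurations,

  `P_p(E_n) = θ_n(p) - θ(p)`,  `θ_n(p) = P_p(0 ↔ ∂B(n))`            (`real_finiteArm_eq`).

`θ_n` is a polynomial in `p` (`DCT16.continuous_thetaN`) and `θ = inf_n θ_n` is non-decreasing, hence
**right-continuous at every `p`** (Grimmett 1999, Lemma (8.9)/(8.10): an infimum of continuous functions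
is upper semicontinuous; `theta_rightContinuous`), so `p ↦ P_p(E_n)` is right-continuous at every `p`
in every world (`real_finiteArm_rightContinuous`). Consequently any domination of the finite-cluster
one-arm probabilities on a right neighbourhood `(p_c, p_c + δ_n)` of the critical point passes to `p_c`
itself (`real_finiteArm_criticalProbI_le_of_supercritical`), and a domination by a sequence `g` with
`Σ (n+1)² g(n) < ∞` gives the registered stub (`stub_criticalRadiusMoment_of_supercriticalDomination`,
registered sub-goal of stmt-CriticalPhenomena-0852) — WITHOUT using the hypothesis `θ(p_c) > 0`.

Remark (why this is a reformulation and not an attack, recorded for the planners): for `p > p_c` every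
`P_p(E_n)` decays exponentially in `n` (landed STUB 1, from Duminil-Copin–Kozma–Tassion 2020), but with
constants that die as `p ↓ p_c`; a UNIFORM summable domination down to `p_c` is false in the real world
(there `P_{p_c}(E_n) = θ_n(p_c)` is not summable against `(n+1)²` since `χ(p_c) = ∞`) and is exactly the
"first-order type" property of a jump world. No new definitions; no named-fact hypothesis.
-/

noncomputable section

namespace Summit.CriticalPhenomena.PercolationContinuityZ3.Theorems.TruncatedSusceptibilityFiniteOfTheta

open MeasureTheory Filter Topology
open Literature.Probability.Percolation Literature.Probability.LatticeModels
open Literature.Probability.Percolation.DCT16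

namespace SupercriticalLimit

variable {d : ℕ}

/-- For a lattice configuration (`ω ⊆ E(ℤ^d)`), an infinite cluster at `0` reaches every sphere:
`{|C(0)| = ∞} ⊆ {0 ↔ ∂B(n)}` (first exit from the box; Grimmett 1999 §1.4). -/
theorem mem_siteToBoundary_of_mem_percolatesAt {ω : BondConfig (Site d)}
    (hω : ω ⊆ (zdGraph d).edgeSet) (h : ω ∈ percolatesAt (0 : Site d)) (n : ℕ) :
    ω ∈ siteToBoundary d n := by
  obtain ⟨z, hz, hzn⟩ : ∃ z ∈ openCluster ω 0, z ∉ box d n := by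
    by_contra hcon
    push Not at hcon
    exact h ((box d n).finite_toSet.subset fun z hz => Finset.mem_coe.2 (hcon z hz))
  rw [← armEvent_zero]
  exact armEvent_of_pathIn hω (pathIn_univ_of_reachable hz) (Or.inl (by rwa [sub_zero]))

/-- **`P_p(0 ↔ ∂B(n), |C(0)| < ∞) = θ_n(p) - θ(p)`**: the finite-cluster one-arm probability is the
difference of the one-arm probability and the percolation probability. -/
theorem real_finiteArm_eq (p : unitInterval) (n : ℕ) :
    (bondPercolation (zdGraph d) p).real (siteToBoundary d n \ percolatesAt 0) =
      (bondPercolation (zdGraph d) p).real (siteToBoundary d n) - theta (zdGraph d) 0 p := by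
  rw [measureReal_sdiff' (measurableSet_percolatesAt_holds (0 : Site d))]
  have hunion : (bondPercolation (zdGraph d) p).real (siteToBoundary d n ∪ percolatesAt 0) =
      (bondPercolation (zdGraph d) p).real (siteToBoundary d n) := by
    refine real_congr_of_forall_subset_edgeSet (zdGraph d) p fun ω hω => ⟨fun h => ?_, fun h => Or.inl h⟩
    rcases h with h | h
    · exact h
    · exact mem_siteToBoundary_of_mem_percolatesAt hω h n
  rw [hunion]
  rfl

/-- `0 ≤ P_p(E_n)`. -/
theorem real_finiteArm_nonneg (p : unitInterval) (n : ℕ) :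
    0 ≤ (bondPercolation (zdGraph d) p).real (siteToBoundary d n \ percolatesAt 0) :=
  measureReal_nonneg

/-- **Right-continuity of `θ`** (Grimmett 1999, Lemma (8.9)–(8.10)): `θ = inf_n θ_n` with `θ_n`
continuous makes `θ` upper semicontinuous, and `θ` is non-decreasing; hence for every `p` and `ε > 0`
there is `δ > 0` with `θ(q) < θ(p) + ε` (and `θ(p) ≤ θ(q)`) for all `q ∈ [p, p + δ)`. Stated in `ε`–`δ`
form on `unitInterval`. -/
theorem theta_rightContinuous (p : unitInterval) {ε : ℝ} (hε : 0 < ε) :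
    ∃ δ : ℝ, 0 < δ ∧ ∀ q : unitInterval, (p : ℝ) ≤ q → (q : ℝ) < p + δ →
      theta (zdGraph d) 0 p ≤ theta (zdGraph d) 0 q ∧ theta (zdGraph d) 0 q < theta (zdGraph d) 0 p + ε := by
  -- choose `n` with `θ_n(p) < θ(p) + ε/2` (`θ(p) = inf_n θ_n(p)`)
  obtain ⟨n, hn⟩ : ∃ n : ℕ, (bondPercolation (zdGraph d) p).real (siteToBoundary d n) <
      theta (zdGraph d) 0 p + ε / 2 := by
    by_contra hcon
    push Not at hcon
    have := le_theta_of_forall_le_real_siteToBoundary p hcon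
    linarith
  -- continuity of `θ_n` at `p`
  have hcont : ContinuousAt (thetaN d n) (p : ℝ) := (continuous_thetaN d n).continuousAt
  obtain ⟨δ, hδ, hδε⟩ := Metric.continuousAt_iff.1 hcont (ε / 2) (by positivity)
  refine ⟨δ, hδ, fun q hpq hqδ => ⟨theta_mono_holds (zdGraph d) 0 (Subtype.coe_le_coe.1 hpq), ?_⟩⟩
  have hdist : dist (q : ℝ) (p : ℝ) < δ := by
    rw [Real.dist_eq, abs_sub_lt_iff]
    constructor <;> linarith
  have hq := hδε hdist
  rw [Real.dist_eq, thetaN_coe, thetaN_coe] at hq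
  have hq' : (bondPercolation (zdGraph d) q).real (siteToBoundary d n) <
      (bondPercolation (zdGraph d) p).real (siteToBoundary d n) + ε / 2 := by
    have := (abs_sub_lt_iff.1 hq).1
    linarith
  calc theta (zdGraph d) 0 q ≤ (bondPercolation (zdGraph d) q).real (siteToBoundary d n) :=
        theta_le_real_siteToBoundary q n
    _ < theta (zdGraph d) 0 p + ε := by linarith

/-- **Right-continuity of the finite-cluster one-arm probabilities**: for every `p`, `n` and `ε > 0`
there is `δ > 0` with `|P_q(E_n) - P_p(E_n)| < ε` for all `q ∈ [p, p + δ)`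
(`P_q(E_n) = θ_n(q) - θ(q)`, `θ_n` continuous, `θ` right-continuous). -/
theorem real_finiteArm_rightContinuous (p : unitInterval) (n : ℕ) {ε : ℝ} (hε : 0 < ε) :
    ∃ δ : ℝ, 0 < δ ∧ ∀ q : unitInterval, (p : ℝ) ≤ q → (q : ℝ) < p + δ →
      |(bondPercolation (zdGraph d) q).real (siteToBoundary d n \ percolatesAt 0) -
        (bondPercolation (zdGraph d) p).real (siteToBoundary d n \ percolatesAt 0)| < ε := by
  obtain ⟨δ₁, hδ₁, h₁⟩ := theta_rightContinuous (d := d) p (half_pos hε)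
  have hcont : ContinuousAt (thetaN d n) (p : ℝ) := (continuous_thetaN d n).continuousAt
  obtain ⟨δ₂, hδ₂, h₂⟩ := Metric.continuousAt_iff.1 hcont (ε / 2) (by positivity)
  refine ⟨min δ₁ δ₂, lt_min hδ₁ hδ₂, fun q hpq hq => ?_⟩
  have hq₁ : (q : ℝ) < p + δ₁ := lt_of_lt_of_le hq (by linarith [min_le_left δ₁ δ₂])
  have hq₂ : (q : ℝ) < p + δ₂ := lt_of_lt_of_le hq (by linarith [min_le_right δ₁ δ₂])
  obtain ⟨hθle, hθlt⟩ := h₁ q hpq hq₁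
  have hdist : dist (q : ℝ) (p : ℝ) < δ₂ := by
    rw [Real.dist_eq, abs_sub_lt_iff]
    constructor <;> linarith
  have hN := h₂ hdist
  rw [Real.dist_eq, thetaN_coe, thetaN_coe] at hN
  rw [real_finiteArm_eq, real_finiteArm_eq, abs_sub_lt_iff] at *
  obtain ⟨hN1, hN2⟩ := hN
  constructor <;> linarith

/-- **Supercritical domination passes to `p_c`** (on `ℤ^d`, `d ≥ 2`, where `p_c < 1`): if
`P_p(E_n) ≤ c` for all `p` in some right neighbourhood `(p_c, p_c + δ)` of the critical point, then
`P_{p_c}(E_n) ≤ c`. -/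
theorem real_finiteArm_criticalProbI_le_of_supercritical (hd : 2 ≤ d) (n : ℕ) {c δ : ℝ} (hδ : 0 < δ)
    (h : ∀ p : unitInterval, criticalProb (zdGraph d) (0 : Site d) < (p : ℝ) →
      (p : ℝ) < criticalProb (zdGraph d) (0 : Site d) + δ →
        (bondPercolation (zdGraph d) p).real (siteToBoundary d n \ percolatesAt 0) ≤ c) :
    (bondPercolation (zdGraph d) (criticalProbI d)).real (siteToBoundary d n \ percolatesAt 0) ≤ c := by
  set P : unitInterval → ℝ := fun p =>
    (bondPercolation (zdGraph d) p).real (siteToBoundary d n \ percolatesAt 0) with hP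
  by_contra hcon
  push Not at hcon
  -- `ε = P(p_c) - c > 0`
  obtain ⟨δ₁, hδ₁, h₁⟩ :=
    real_finiteArm_rightContinuous (d := d) (criticalProbI d) n (sub_pos.2 hcon)
  have hpc1 : criticalProb (zdGraph d) (0 : Site d) < 1 := criticalProb_zd_lt_one hd
  have hpc0 : 0 ≤ criticalProb (zdGraph d) (0 : Site d) := (criticalProb_mem_Icc _ _).1
  -- a parameter `q ∈ (p_c, p_c + min δ δ₁) ∩ [0, 1]`
  set t : ℝ := min (min δ δ₁) (1 - criticalProb (zdGraph d) (0 : Site d)) / 2 with ht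
  have ht0 : 0 < t := by
    have : 0 < min (min δ δ₁) (1 - criticalProb (zdGraph d) (0 : Site d)) :=
      lt_min (lt_min hδ hδ₁) (by linarith)
    positivity
  have htδ : t < δ := by
    have h1 : min (min δ δ₁) (1 - criticalProb (zdGraph d) (0 : Site d)) ≤ δ :=
      (min_le_left _ _).trans (min_le_left _ _)
    have h2 : 0 < min (min δ δ₁) (1 - criticalProb (zdGraph d) (0 : Site d)) :=
      lt_min (lt_min hδ hδ₁) (by linarith)
    rw [ht]; linarith
  have htδ₁ : t < δ₁ := by
    have h1 : min (min δ δ₁) (1 - criticalProb (zdGraph d) (0 : Site d)) ≤ δ₁ :=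
      (min_le_left _ _).trans (min_le_right _ _)
    have h2 : 0 < min (min δ δ₁) (1 - criticalProb (zdGraph d) (0 : Site d)) :=
      lt_min (lt_min hδ hδ₁) (by linarith)
    rw [ht]; linarith
  have ht1 : criticalProb (zdGraph d) (0 : Site d) + t ≤ 1 := by
    have h1 : min (min δ δ₁) (1 - criticalProb (zdGraph d) (0 : Site d)) ≤
        1 - criticalProb (zdGraph d) (0 : Site d) := min_le_right _ _
    rw [ht]; linarith
  set q : unitInterval := ⟨criticalProb (zdGraph d) (0 : Site d) + t, ⟨by linarith, ht1⟩⟩ with hq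
  have hq_gt : criticalProb (zdGraph d) (0 : Site d) < (q : ℝ) := by
    change criticalProb (zdGraph d) (0 : Site d) < criticalProb (zdGraph d) (0 : Site d) + t
    linarith
  have hq_lt : (q : ℝ) < criticalProb (zdGraph d) (0 : Site d) + δ := by
    change criticalProb (zdGraph d) (0 : Site d) + t < criticalProb (zdGraph d) (0 : Site d) + δ
    linarith
  have hdom := h q hq_gt hq_lt
  have hpc_le : ((criticalProbI d : unitInterval) : ℝ) ≤ q := by
    rw [coe_criticalProbI]; exact hq_gt.le
  have hq_lt₁ : (q : ℝ) < (criticalProbI d : unitInterval) + δ₁ := by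
    rw [coe_criticalProbI]
    change criticalProb (zdGraph d) (0 : Site d) + t < criticalProb (zdGraph d) (0 : Site d) + δ₁
    linarith
  have hclose := h₁ q hpc_le hq_lt₁
  rw [abs_sub_lt_iff] at hclose
  obtain ⟨-, h2⟩ := hclose
  -- `P(p_c) - P(q) < P(p_c) - c` contradicts `P(q) ≤ c`
  change P q ≤ c at hdom
  change P (criticalProbI d) - P q < P (criticalProbI d) - c at h2
  linarith

/-- **Summable domination near `p_c⁺` gives the finite second shell moment AT `p_c`** (`ℤ^d`, `d ≥ 2`):
if `g` with `Σ (n+1)² g(n) < ∞` dominates `P_p(E_n)` on a right neighbourhood `(p_c, p_c + δ_n)` of `p_c`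
for every `n`, then `Σ (n+1)² P_{p_c}(E_n) < ∞`. -/
theorem summable_criticalProbI_of_supercriticalDomination (hd : 2 ≤ d) {g : ℕ → ℝ}
    (hg : Summable fun n : ℕ => ((n : ℝ) + 1) ^ 2 * g n)
    (h : ∀ n : ℕ, ∃ δ : ℝ, 0 < δ ∧ ∀ p : unitInterval, criticalProb (zdGraph d) (0 : Site d) < (p : ℝ) →
      (p : ℝ) < criticalProb (zdGraph d) (0 : Site d) + δ →
        (bondPercolation (zdGraph d) p).real (siteToBoundary d n \ percolatesAt 0) ≤ g n) :
    Summable fun n : ℕ => ((n : ℝ) + 1) ^ 2 *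
      (bondPercolation (zdGraph d) (criticalProbI d)).real (siteToBoundary d n \ percolatesAt 0) := by
  refine hg.of_nonneg_of_le (fun n => mul_nonneg (by positivity) (real_finiteArm_nonneg _ n)) fun n => ?_
  obtain ⟨δ, hδ, hn⟩ := h n
  exact mul_le_mul_of_nonneg_left
    (real_finiteArm_criticalProbI_le_of_supercritical hd n hδ hn) (by positivity)

end SupercriticalLimit

open SupercriticalLimit in
/-- **STUB 2 from a uniform supercritical radius tail** (registered sub-goal of stmt-CriticalPhenomena-0852;
reformulation (R2) of the line's STUB-2 analysis made a reduction): if some `g` with `Σ (n+1)² g(n) < ∞`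
dominates the finite-cluster one-arm probabilities `P_p(0 ↔ ∂B(n), |C(0)| < ∞)` of bond percolation on
`ℤ³` for all `p` in a right neighbourhood `(p_c, p_c + δ_n)` of the critical point, then the registered
stub `stub_criticalRadiusMoment` holds — by right-continuity of `p ↦ P_p(0 ↔ ∂B(n), |C(0)| < ∞)` at
`p_c` (`θ_n` polynomial, `θ` right-continuous), without using `θ(p_c) > 0`. -/
theorem stub_criticalRadiusMoment_of_supercriticalDomination : (∃ g : ℕ → ℝ, (Summable fun n : ℕ => ((n : ℝ) + 1) ^ 2 * g n) ∧ ∀ n : ℕ, ∃ δ : ℝ, 0 < δ ∧ ∀ p : unitInterval, criticalProb (zdGraph 3) (0 : Site 3) < (p : ℝ) → (p : ℝ) < criticalProb (zdGraph 3) (0 : Site 3) + δ → (bondPercolation (zdGraph 3) p).real (siteToBoundary 3 n \ percolatesAt 0) ≤ g n) → 0 < theta (zdGraph 3) (0 : Site 3) (criticalProbI 3) → Summable fun n : ℕ => ((n : ℝ) + 1) ^ 2 * (bondPercolation (zdGraph 3) (criticalProbI 3)).real (siteToBoundary 3 n \ percolatesAt 0) :=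
  fun ⟨_, hg, h⟩ _ => summable_criticalProbI_of_supercriticalDomination (d := 3) (by norm_num) hg h

end Summit.CriticalPhenomena.PercolationContinuityZ3.Theorems.TruncatedSusceptibilityFiniteOfTheta

end
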